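import Summits.NavierStokesRegularity.NavierStokesRegularity.Theorems.ExtremalBiaxialitySubcritical.Negative.MaximalityFree

/-!
# Crux `ExtremalBiaxialitySubcritical` (stmt-NavierStokesRegularity-11609), negative side:
# any finite-energy Type-I blow-up refutes the crux; the sibling crux `MustSqueeze` is bypassable

Route `SqueezeCycle`. Extracted from the crux work file `Cruxes/ExtremalBiaxialitySubcritical/Disproof.lean`
(cdisprove adversary, generation 3, D-0016), §7. Pure logic over two analytic statements taken as
HYPOTHESES (inlined, not declared as facts):

* **(Q) physical-variables quarter law** — a maximal smooth finite-energy solution of the unforced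
  system from a rapidly decaying datum squeezes at the critical rate near its blow-up time: for every
  `θ < 1/4`, frequently as `t ↑ T`, some point has `(T − t)·λ₂(sym ∇u(t,x)) ≥ θ`. On paper: Miller's
  enstrophy identity `E' = −ν‖∇ω‖² − 4∫det S ≤ 2‖λ₂⁺(t)‖_∞ E` (Miller 2019 Thm 1.1 at `q = ∞`;
  Betchov; tree `production_identity`, `neg_det_half_add_transpose_le`) gives
  `E(t) ≤ E(t₀)((T−t₀)/(T−t))^{2a}` when `(T−s)‖λ₂⁺(s)‖_∞ ≤ a` on `[t₀,T)`, while blow-up forces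
  Leray's rate `2E(t) = ‖∇u(t)‖₂² ≥ c ν^{3/2} (T−t)^{−1/2}` (Ożański–Pooley 2018 Cor. 6.25) —
  impossible for `a < 1/4`. Enstrophy is FINITE here: no localisation problem.
* **(Z) zoom at squeeze points** — a Type-I blow-up with squeeze points of gauge value `≥ θ`
  frequently near `T` yields an element of some Type-I model class `𝒦_C` (the crux's inline class,
  verbatim) attaining the crux's lower two-frame clause with value `θ` at `(−1, 0)`: the ingredients of
  the route's support `SingularZoom` (uniform Type-I bound, Albritton–Barker 2019 Lemma 2.5 scaled
  energies, KNSS compactness, `ν`-rescaling) centred at the moving points `(x_k, t_k)`.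

Results:
* `not_crux_of_typeI_blowup` — (Q) → (Z) → any maximal solution as above which blows up at the
  Type-I rate refutes `ExtremalBiaxialitySubcritical` (via `not_crux_iff_exists_point`): the kill
  shape of the crux in its final form — no evaluation of `Λ` on the blow-up profile is needed.
* `not_crux_of_blowup` — with the route's borrowed `NoTypeII`, ANY finite-time blow-up from a smooth
  rapidly decaying datum refutes the crux.
* `clay_of_crux_sans_mustSqueeze` — **(Q) → (Z) → NoTypeII → NoBlowupToClay →
  ExtremalBiaxialitySubcritical → NavierStokesRegularity**: a deciding chain for the route in which
  the open-problem-strength sibling crux `MustSqueeze` (and its localisation difficulty on `𝒦_C`) does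
  not occur; compare `closes` (`MustSqueeze → ExtremalElementExists → crux → SingularZoom → NoTypeII →
  NoBlowupToClay → …`). Re-lining information for planners; not a refutation.
-/

noncomputable section

open Set Function Filter MeasureTheory
open scoped RealInnerProductSpace Topology

namespace Summit.NavierStokesRegularity.NavierStokesRegularity.Theorems.ExtremalBiaxialitySubcritical.Negative

open Literature.Analysis.FluidPDE
open Summit.NavierStokesRegularity.NavierStokesRegularity.Theses

/-- **Any Type-I blow-up refutes the crux**, given (Q) the physical-variables quarter law and (Z)
the zoom at squeeze points (module docstring): (Q) at `θ = 1/8 < 1/4` gives squeeze points, (Z) an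
element of some `𝒦_C` with `Λ(−1,0) ≥ 1/8`, and `not_crux_iff_exists_point` concludes. [folklore] -/
theorem not_crux_of_typeI_blowup
    (hQ : ∀ (ν T : ℝ), 0 < ν → 0 < T → ∀ (u : ℝ → EuclideanSpace ℝ (Fin 3) → EuclideanSpace ℝ (Fin 3)) (p : ℝ → EuclideanSpace ℝ (Fin 3) → ℝ),
        IsMaximalSmoothSolution ν 0 u p T → IsLerayHopfOn T ν 0 (u 0) u → HasRapidSpatialDecay (u 0) →
          ∀ θ : ℝ, θ < 1 / 4 → ∃ᶠ t in 𝓝[<] T, ∃ x : EuclideanSpace ℝ (Fin 3),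
            θ ≤ (T - t) * strainEigenvalues (fderiv ℝ (u t) x : EuclideanSpace ℝ (Fin 3) →ₗ[ℝ] EuclideanSpace ℝ (Fin 3)) finrank_euclideanSpace_fin 1)
    (hZ : ∀ (ν T : ℝ), 0 < ν → 0 < T → ∀ (u : ℝ → EuclideanSpace ℝ (Fin 3) → EuclideanSpace ℝ (Fin 3)) (p : ℝ → EuclideanSpace ℝ (Fin 3) → ℝ) (θ : ℝ),
        IsMaximalSmoothSolution ν 0 u p T → IsLerayHopfOn T ν 0 (u 0) u → HasRapidSpatialDecay (u 0) →
          IsTypeIBlowup u T →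
          (∃ᶠ t in 𝓝[<] T, ∃ x : EuclideanSpace ℝ (Fin 3),
            θ ≤ (T - t) * strainEigenvalues (fderiv ℝ (u t) x : EuclideanSpace ℝ (Fin 3) →ₗ[ℝ] EuclideanSpace ℝ (Fin 3)) finrank_euclideanSpace_fin 1) →
          ∃ (C : ℝ) (u' : ℝ → EuclideanSpace ℝ (Fin 3) → EuclideanSpace ℝ (Fin 3)), (ContDiffOn ℝ (⊤ : ℕ∞) (Function.uncurry u') (Set.Iio 0 ×ˢ Set.univ) ∧ (∀ t < 0, Literature.Analysis.FluidPDE.VectorCalculus.IsDivFree (u' t)) ∧ (∀ s t : ℝ, s < t → t < 0 → ∀ x, u' t x = Literature.Analysis.FluidPDE.heatFlow (u' s) (t-s) x - ∫ τ in Set.Ioo s t, ∫ y, ((-(inner ℝ (x-y) (u' τ y) / (2*(t-τ)) * Literature.Analysis.UnboundedOperators.heatKernel (t-τ) (x-y))) • u' τ y + (∫ σ in Set.Ioi (t-τ), Literature.Analysis.UnboundedOperators.heatKernel σ (x-y) / (4*σ^2)) • (inner ℝ (x-y) (u' τ y) • u' τ y + inner ℝ (u' τ y) (u' τ y) • (x-y)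 + inner ℝ (x-y) (u' τ y) • u' τ y) - ((∫ σ in Set.Ioi (t-τ), Literature.Analysis.UnboundedOperators.heatKernel σ (x-y) / (8*σ^3)) * (inner ℝ (x-y) (u' τ y) * inner ℝ (x-y) (u' τ y))) • (x-y))) ∧ Literature.Analysis.FluidPDE.HasTypeITimeDecay C u' ∧ (∀ (x₀ : EuclideanSpace ℝ (Fin 3)) (t₀ r : ℝ), t₀ ≤ 0 → 0 < r → (∀ t, t₀ - r^2 < t → t < t₀ → r⁻¹ * ∫ x in Metric.ball x₀ r, ‖u' t x‖^2 ≤ C) ∧ r⁻¹ * ∫ t in Set.Ioo (t₀ - r^2) t₀, ∫ x in Metric.ball x₀ r, ‖fderiv ℝ (u' t) x‖^2 ≤ C)) ∧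
            (∃ v w : EuclideanSpace ℝ (Fin 3), ‖v‖ = 1 ∧ ‖w‖ = 1 ∧ inner ℝ v w = 0 ∧ ∀ α β : ℝ, θ * (α^2 + β^2) ≤ (-(-1 : ℝ)) * inner ℝ (fderiv ℝ (u' (-1 : ℝ)) 0 (α • v + β • w)) (α • v + β • w)))
    {ν T : ℝ} (hν : 0 < ν) (hT : 0 < T) {u : ℝ → EuclideanSpace ℝ (Fin 3) → EuclideanSpace ℝ (Fin 3)} {p : ℝ → EuclideanSpace ℝ (Fin 3) → ℝ}
    (hmax : IsMaximalSmoothSolution ν 0 u p T) (hLH : IsLerayHopfOn T ν 0 (u 0) u)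
    (hdec : HasRapidSpatialDecay (u 0)) (hTI : IsTypeIBlowup u T) :
    ¬ SqueezeCycle.ExtremalBiaxialitySubcritical := by
  have hfreq := hQ ν T hν hT u p hmax hLH hdec (1 / 8) (by norm_num)
  obtain ⟨C, u', hu', hGE⟩ := hZ ν T hν hT u p (1 / 8) hmax hLH hdec hTI hfreq
  exact not_crux_iff_exists_point.2 ⟨C, u', -1, 0, by norm_num, hu', hGE⟩

/-- **Given the borrowed `NoTypeII`, any finite-time blow-up from a smooth rapidly decaying datum
refutes the crux.** [folklore] -/
theorem not_crux_of_blowup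
    (hQ : ∀ (ν T : ℝ), 0 < ν → 0 < T → ∀ (u : ℝ → EuclideanSpace ℝ (Fin 3) → EuclideanSpace ℝ (Fin 3)) (p : ℝ → EuclideanSpace ℝ (Fin 3) → ℝ),
        IsMaximalSmoothSolution ν 0 u p T → IsLerayHopfOn T ν 0 (u 0) u → HasRapidSpatialDecay (u 0) →
          ∀ θ : ℝ, θ < 1 / 4 → ∃ᶠ t in 𝓝[<] T, ∃ x : EuclideanSpace ℝ (Fin 3),
            θ ≤ (T - t) * strainEigenvalues (fderiv ℝ (u t) x : EuclideanSpace ℝ (Fin 3) →ₗ[ℝ] EuclideanSpace ℝ (Fin 3)) finrank_euclideanSpace_fin 1)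
    (hZ : ∀ (ν T : ℝ), 0 < ν → 0 < T → ∀ (u : ℝ → EuclideanSpace ℝ (Fin 3) → EuclideanSpace ℝ (Fin 3)) (p : ℝ → EuclideanSpace ℝ (Fin 3) → ℝ) (θ : ℝ),
        IsMaximalSmoothSolution ν 0 u p T → IsLerayHopfOn T ν 0 (u 0) u → HasRapidSpatialDecay (u 0) →
          IsTypeIBlowup u T →
          (∃ᶠ t in 𝓝[<] T, ∃ x : EuclideanSpace ℝ (Fin 3),
            θ ≤ (T - t) * strainEigenvalues (fderiv ℝ (u t) x : EuclideanSpace ℝ (Fin 3) →ₗ[ℝ] EuclideanSpace ℝ (Fin 3)) finrank_euclideanSpace_fin 1) →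
          ∃ (C : ℝ) (u' : ℝ → EuclideanSpace ℝ (Fin 3) → EuclideanSpace ℝ (Fin 3)), (ContDiffOn ℝ (⊤ : ℕ∞) (Function.uncurry u') (Set.Iio 0 ×ˢ Set.univ) ∧ (∀ t < 0, Literature.Analysis.FluidPDE.VectorCalculus.IsDivFree (u' t)) ∧ (∀ s t : ℝ, s < t → t < 0 → ∀ x, u' t x = Literature.Analysis.FluidPDE.heatFlow (u' s) (t-s) x - ∫ τ in Set.Ioo s t, ∫ y, ((-(inner ℝ (x-y) (u' τ y) / (2*(t-τ)) * Literature.Analysis.UnboundedOperators.heatKernel (t-τ) (x-y))) • u' τ y + (∫ σ in Set.Ioi (t-τ), Literature.Analysis.UnboundedOperators.heatKernel σ (x-y) / (4*σ^2)) • (inner ℝ (x-y) (u' τ y) • u' τ y + inner ℝ (u' τ y) (u' τ y) • (x-y) + inner ℝ (x-y) (u' τ y) • u' τ y) - ((∫ σ in Set.Ioi (t-τ), Literature.Analysis.UnboundedOperators.heatKernel σ (x-y) / (8*σ^3)) * (inner ℝ (x-y) (u' τ y) * inner ℝ (x-y) (u' τ y))) • (x-y))) ∧ Literature.Analysis.FluidPDE.HasTypeITimeDecay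 C u' ∧ (∀ (x₀ : EuclideanSpace ℝ (Fin 3)) (t₀ r : ℝ), t₀ ≤ 0 → 0 < r → (∀ t, t₀ - r^2 < t → t < t₀ → r⁻¹ * ∫ x in Metric.ball x₀ r, ‖u' t x‖^2 ≤ C) ∧ r⁻¹ * ∫ t in Set.Ioo (t₀ - r^2) t₀, ∫ x in Metric.ball x₀ r, ‖fderiv ℝ (u' t) x‖^2 ≤ C)) ∧
            (∃ v w : EuclideanSpace ℝ (Fin 3), ‖v‖ = 1 ∧ ‖w‖ = 1 ∧ inner ℝ v w = 0 ∧ ∀ α β : ℝ, θ * (α^2 + β^2) ≤ (-(-1 : ℝ)) * inner ℝ (fderiv ℝ (u' (-1 : ℝ)) 0 (α • v + β • w)) (α • v + β • w)))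
    (hII : SqueezeCycle.NoTypeII) {ν T : ℝ} (hν : 0 < ν) (hT : 0 < T) {u : ℝ → EuclideanSpace ℝ (Fin 3) → EuclideanSpace ℝ (Fin 3)}
    {p : ℝ → EuclideanSpace ℝ (Fin 3) → ℝ} (hmax : IsMaximalSmoothSolution ν 0 u p T)
    (hLH : IsLerayHopfOn T ν 0 (u 0) u) (hdec : HasRapidSpatialDecay (u 0)) :
    ¬ SqueezeCycle.ExtremalBiaxialitySubcritical :=
  not_crux_of_typeI_blowup hQ hZ hν hT hmax hLH hdec (hII ν T hν hT u p hmax hLH hdec)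

/-- **Clay (A) from the crux without `MustSqueeze`**: (Q) → (Z) → `NoTypeII` → `NoBlowupToClay` →
`ExtremalBiaxialitySubcritical` → `NavierStokesRegularity`. A finite-energy classical solution with
no smooth extension past `T` is maximal, `NoTypeII` makes it Type I, and `not_crux_of_typeI_blowup`
contradicts the crux; so every such solution extends, and `NoBlowupToClay` gives Clay (A). [folklore] -/
theorem clay_of_crux_sans_mustSqueeze
    (hQ : ∀ (ν T : ℝ), 0 < ν → 0 < T → ∀ (u : ℝ → EuclideanSpace ℝ (Fin 3) → EuclideanSpace ℝ (Fin 3)) (p : ℝ → EuclideanSpace ℝ (Fin 3) → ℝ),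
        IsMaximalSmoothSolution ν 0 u p T → IsLerayHopfOn T ν 0 (u 0) u → HasRapidSpatialDecay (u 0) →
          ∀ θ : ℝ, θ < 1 / 4 → ∃ᶠ t in 𝓝[<] T, ∃ x : EuclideanSpace ℝ (Fin 3),
            θ ≤ (T - t) * strainEigenvalues (fderiv ℝ (u t) x : EuclideanSpace ℝ (Fin 3) →ₗ[ℝ] EuclideanSpace ℝ (Fin 3)) finrank_euclideanSpace_fin 1)
    (hZ : ∀ (ν T : ℝ), 0 < ν → 0 < T → ∀ (u : ℝ → EuclideanSpace ℝ (Fin 3) → EuclideanSpace ℝ (Fin 3)) (p : ℝ → EuclideanSpace ℝ (Fin 3) → ℝ) (θ : ℝ),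
        IsMaximalSmoothSolution ν 0 u p T → IsLerayHopfOn T ν 0 (u 0) u → HasRapidSpatialDecay (u 0) →
          IsTypeIBlowup u T →
          (∃ᶠ t in 𝓝[<] T, ∃ x : EuclideanSpace ℝ (Fin 3),
            θ ≤ (T - t) * strainEigenvalues (fderiv ℝ (u t) x : EuclideanSpace ℝ (Fin 3) →ₗ[ℝ] EuclideanSpace ℝ (Fin 3)) finrank_euclideanSpace_fin 1) →
          ∃ (C : ℝ) (u' : ℝ → EuclideanSpace ℝ (Fin 3) → EuclideanSpace ℝ (Fin 3)), (ContDiffOn ℝ (⊤ : ℕ∞) (Function.uncurry u') (Set.Iio 0 ×ˢ Set.univ) ∧ (∀ t < 0, Literature.Analysis.FluidPDE.VectorCalculus.IsDivFree (u' t)) ∧ (∀ s t : ℝ, s < t → t < 0 → ∀ x, u' t x = Literature.Analysis.FluidPDE.heatFlow (u' s) (t-s) x - ∫ τ in Set.Ioo s t, ∫ y, ((-(inner ℝ (x-y) (u' τ y) / (2*(t-τ)) * Literature.Analysis.UnboundedOperators.heatKernel (t-τ) (x-y))) • u' τ y + (∫ σ in Set.Ioi (t-τ), Literature.Analysis.UnboundedOperators.heatKernel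 σ (x-y) / (4*σ^2)) • (inner ℝ (x-y) (u' τ y) • u' τ y + inner ℝ (u' τ y) (u' τ y) • (x-y) + inner ℝ (x-y) (u' τ y) • u' τ y) - ((∫ σ in Set.Ioi (t-τ), Literature.Analysis.UnboundedOperators.heatKernel σ (x-y) / (8*σ^3)) * (inner ℝ (x-y) (u' τ y) * inner ℝ (x-y) (u' τ y))) • (x-y))) ∧ Literature.Analysis.FluidPDE.HasTypeITimeDecay C u' ∧ (∀ (x₀ : EuclideanSpace ℝ (Fin 3)) (t₀ r : ℝ), t₀ ≤ 0 → 0 < r → (∀ t, t₀ - r^2 < t → t < t₀ → r⁻¹ * ∫ x in Metric.ball x₀ r, ‖u' t x‖^2 ≤ C) ∧ r⁻¹ * ∫ t in Set.Ioo (t₀ - r^2) t₀, ∫ x in Metric.ball x₀ r, ‖fderiv ℝ (u' t) x‖^2 ≤ C)) ∧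
            (∃ v w : EuclideanSpace ℝ (Fin 3), ‖v‖ = 1 ∧ ‖w‖ = 1 ∧ inner ℝ v w = 0 ∧ ∀ α β : ℝ, θ * (α^2 + β^2) ≤ (-(-1 : ℝ)) * inner ℝ (fderiv ℝ (u' (-1 : ℝ)) 0 (α • v + β • w)) (α • v + β • w)))
    (hII : SqueezeCycle.NoTypeII) (hClay : SqueezeCycle.NoBlowupToClay)
    (hX : SqueezeCycle.ExtremalBiaxialitySubcritical) : NavierStokesRegularity := by
  apply hClay
  intro ν T hν hT u p hcl hLH hdec
  by_contra hext
  exact not_crux_of_blowup hQ hZ hII hν hT ⟨hcl, hext⟩ hLH hdec hX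

end Summit.NavierStokesRegularity.NavierStokesRegularity.Theorems.ExtremalBiaxialitySubcritical.Negative

end
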